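import Literature.AlgebraicGeometry.Resolution.HasseSchmidtChartOrder
import Literature.AlgebraicGeometry.Resolution.HasseSchmidtPurityCriterion
import Mathlib.FieldTheory.Perfect
import Mathlib.Algebra.CharP.Algebra
import Mathlib.RingTheory.Algebraic.Integral
import HarnessLib

/-!
# Chart-uniform purity: the locus where the initial form of a section is a `q`-th power of a linear form is cut out
# by the NON-PURE global Hasse–Schmidt coefficients

Topic: `Literature/AlgebraicGeometry/Resolution`. Continuation of `HasseSchmidtChartOrder.lean` (ONE Hasse–Schmidt
homomorphism `T_A : A → A⟦t_σ⟧` extending the Taylor shift on a `K`-algebra `A` of finite type, formally unramified over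
`K[X_σ]`, `K` PERFECT, with components `D^{[β]} = hsComponent T_A β`, global differential operators) and of
`HasseSchmidtPurityCriterion.lean` (pointwise purity criterion in a local ring with adapted Hasse–Schmidt data).
Exponential characteristic `p` of `K` (so `p = 1` or the prime characteristic; `q = p^e`). PROVED:

* `exists_sum_mul_sub_pow_mem_of_hsComponent_mem` — EXPLICIT pointwise sufficiency (local ring `O`, adapted `u_i`,
  `q`-th roots in the residue field): if `h ∈ 𝔪^q` and the non-pure `D^{[β]}h`, `|β| = q`, lie in `𝔪`, then
  `h ≡ (Σ_m a_m u_m)^q (mod 𝔪^{q+1})` with `ā_m^q = (D^{[q e_m]} h)‾` — the root linear form has as coefficients the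
  `q`-th ROOTS OF THE PURE Hasse–Schmidt coefficients;
* `exists_algebraMap_sub_mem_maximalIdeal` — for a MAXIMAL `𝔭`, every element of `A_𝔭` is congruent mod `𝔪` to an
  element of `A` (the residue field of `A_𝔭` is `A/𝔭`);
* `exists_pow_eq_residueField_of_perfectField` — `K` perfect of exponential characteristic `p`, `A` of finite type over
  `K`, `𝔭` maximal: every element of the residue field of `A_𝔭` is a `p^e`-th power (`A/𝔭` is a finite, hence perfect,
  extension of `K`);
* `sub_pow_mem_iff_hsComponent_mem_of_hasseSchmidt` — **chart-uniform purity criterion**: for every maximal `𝔭`,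
  `O = A_𝔭`, `h ∈ 𝔭^q`: `(∃ y ∈ O, h − y^q ∈ 𝔪_O^{q+1}) ⟺ D^{[β]} h ∈ 𝔭` for every NON-PURE `β` of degree `q` — the
  closed points of the chart where the degree-`q` initial form of `h` is the `q`-th power of a linear form are the
  closed points of the ZERO SET of the global functions `D^{[β]} h`, `β` non-pure of degree `q` (inside `{ord ≥ q}`);
* `exists_adapted_and_roots_of_hasseSchmidt` — at every maximal `𝔭`: the localisation `T` of `T_A`, adapted generators
  `u`, and for every `h ∈ 𝔭^q` with non-pure coefficients in `𝔭` the explicit root `y = Σ a_m u_m`,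
  `ā_m^q = (D^{[q e_m]} h)‾`, `h ≡ y^q (mod 𝔪^{q+1})`.

Bearing (nothing of it asserted): step (ii) «purity correction» and step (iv) «independence of the roots
`ℓ_i(η) = Σ_m (D^{(q_i e_m)} g_i′)(η)^{1/q_i} w̄′_m` is open» of the discharge route for GAP-LEDGER row R20 (Th. 6.14 (1)
of H. Hironaka's 2017 manuscript; campaign `res-hironaka`, lead README §2): both are statements about the SAME global
sections `D^{[β]} g` at all closed points of a chart.

Sources: [Matsumura1987] §27, §30 (proof of Thm. 30.9); [EGAIV4] Thm. 16.11.2, §17.6; [Abad2019pBases] Lemma 6.2;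
[VillamayorU2008ReesDiff] §4.1, Remark 4.3.
-/

noncomputable section

namespace Literature.AlgebraicGeometry.Resolution

open Finsupp IsLocalRing MvPowerSeries

universe u v w

/-! ## Explicit pointwise sufficiency: the root linear form -/

section LocalExplicit

variable {O : Type v} [CommRing O] [IsLocalRing O] {σ : Type*} [Fintype σ] [DecidableEq σ]
  (T : O →+* MvPowerSeries σ O) (p : ℕ) [ExpChar O p]

omit [IsLocalRing O] [Fintype σ] [DecidableEq σ] [ExpChar O p] in
/-- Components are compatible with subtraction. [folklore] -/
private theorem hsComponent_sub_chart (β : σ →₀ ℕ) (a b : O) :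
    hsComponent T β (a - b) = hsComponent T β a - hsComponent T β b := by
  simp [hsComponent]

/-- **Explicit purity (sufficiency with the root).** `O` local of exponential characteristic `p`, `T` a Hasse–Schmidt
homomorphism with adapted generators `u_i` of `𝔪`, every element of the residue field a `p^e`-th power. If `h ∈ 𝔪^{p^e}`
and `D^{[β]} h ∈ 𝔪` for every NON-PURE `β` of degree `p^e`, then for some `a : σ → O` with `ā_m^{p^e} = (D^{[p^e e_m]} h)‾`
(the `p^e`-th roots of the PURE coefficients): `h − (Σ_m a_m u_m)^{p^e} ∈ 𝔪^{p^e + 1}`.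
[cite: Matsumura1987, §27 and §30 (proof of Thm. 30.9)] [cite: Abad2019pBases, Lemma 6.2]
[cite: VillamayorU2008ReesDiff, §4.1 and Remark 4.3] -/
theorem exists_sum_mul_sub_pow_mem_of_hsComponent_mem (hT0 : ∀ b, constantCoeff (T b) = b) {u : σ → O}
    (hu : Ideal.span (Set.range u) = maximalIdeal O)
    (hlin : ∀ i j, hsComponent T (single j 1) (u i) - (if i = j then 1 else 0) ∈ maximalIdeal O)
    {e : ℕ} (hroot : ∀ x : ResidueField O, ∃ y : ResidueField O, y ^ p ^ e = x) {h : O}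
    (hh : h ∈ maximalIdeal O ^ p ^ e)
    (hD : ∀ β : σ →₀ ℕ, degree β = p ^ e → (∀ m, β ≠ p ^ e • Finsupp.single m 1) →
      hsComponent T β h ∈ maximalIdeal O) :
    ∃ a : σ → O, (∀ m, residue O (a m) ^ p ^ e = residue O (hsComponent T (p ^ e • single m 1) h)) ∧
      h - (∑ m, a m * u m) ^ p ^ e ∈ maximalIdeal O ^ (p ^ e + 1) := by
  classical
  have hqpos : 0 < p ^ e := expChar_pow_pos O p e
  have hlift : ∀ m : σ, ∃ a : O,
      residue O a ^ p ^ e = residue O (hsComponent T (p ^ e • single m 1) h) := by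
    intro m
    obtain ⟨ybar, hybar⟩ := hroot (residue O (hsComponent T (p ^ e • single m 1) h))
    obtain ⟨a, ha⟩ := residue_surjective ybar
    exact ⟨a, by rw [ha, hybar]⟩
  choose a ha using hlift
  have hu𝔪 : ∀ i, u i ∈ maximalIdeal O := fun i => hu ▸ Ideal.subset_span ⟨i, rfl⟩
  set y : O := ∑ m, a m * u m with hy
  have hy𝔪 : y ∈ maximalIdeal O := Ideal.sum_mem _ fun m _ => Ideal.mul_mem_left _ _ (hu𝔪 m)
  refine ⟨a, ha, ?_⟩
  have hr : h - y ^ p ^ e ∈ maximalIdeal O ^ p ^ e := sub_mem hh (Ideal.pow_mem_pow hy𝔪 _)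
  refine mem_maximalIdeal_pow_succ_of_hsComponent_mem T hT0 hu hlin (p ^ e) (h - y ^ p ^ e) fun γ hγ => ?_
  rcases hγ.lt_or_eq with hlt | heq
  · exact Ideal.pow_le_self (by omega) (hsComponent_mem_pow T hT0 (maximalIdeal O) (p ^ e) γ hr)
  · rw [hsComponent_sub_chart]
    by_cases hpure : ∃ m, γ = p ^ e • single m 1
    · obtain ⟨m, rfl⟩ := hpure
      rw [hsComponent_smul_pow_expChar_pow T p e (single m 1) y, ← residue_eq_zero_iff, map_sub, map_pow,
        residue_hsComponent_single_sum_mul T hT0 hu hlin a m, ha m, sub_self]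
    · push Not at hpure
      rw [hsComponent_pow_expChar_pow_eq_zero_of_not_dvd T p
        (exists_not_dvd_of_ne_smul_single hqpos heq hpure) y, sub_zero]
      exact hD γ heq hpure

end LocalExplicit

/-! ## Residue fields of localisations at maximal ideals -/

section Residue

variable {A : Type w} [CommRing A]

/-- For a MAXIMAL ideal `𝔭` and `O = A_𝔭`, every element of `O` is congruent modulo `𝔪_O` to the image of an element
of `A` (`a/s ≡ a·t` with `s t ≡ 1 mod 𝔭`): the residue field of `A_𝔭` is `A/𝔭`. [cite: Matsumura1987, §4 (Example 1
and Thm. 4.2: localisation at a maximal ideal, residue field `A/𝔪`)] -/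
theorem exists_algebraMap_sub_mem_maximalIdeal (𝔭 : Ideal A) [𝔭.IsMaximal] (O : Type*) [CommRing O]
    [IsLocalRing O] [Algebra A O] [IsLocalization.AtPrime O 𝔭] (x : O) :
    ∃ a : A, algebraMap A O a - x ∈ maximalIdeal O := by
  obtain ⟨⟨a, s⟩, rfl⟩ := IsLocalization.mk'_surjective 𝔭.primeCompl x
  -- `s` is invertible modulo the maximal ideal `𝔭`
  letI := Ideal.Quotient.field 𝔭
  have hs0 : Ideal.Quotient.mk 𝔭 (s : A) ≠ 0 := by
    rw [Ne, Ideal.Quotient.eq_zero_iff_mem]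
    exact s.2
  obtain ⟨t, ht⟩ := Ideal.Quotient.mk_surjective (Ideal.Quotient.mk 𝔭 (s : A))⁻¹
  have hst : (s : A) * t - 1 ∈ 𝔭 := by
    rw [← Ideal.Quotient.eq_zero_iff_mem, map_sub, map_mul, map_one, ht, mul_inv_cancel₀ hs0, sub_self]
  refine ⟨a * t, ?_⟩
  -- `a t − a/s = (a/s)·(s t − 1)`
  have hkey : algebraMap A O (a * t) - IsLocalization.mk' O a s =
      IsLocalization.mk' O a s * algebraMap A O ((s : A) * t - 1) := by
    rw [map_sub, map_one, mul_sub, mul_one, map_mul, map_mul, ← mul_assoc, IsLocalization.mk'_spec]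
  rw [hkey]
  exact Ideal.mul_mem_left _ _ ((IsLocalization.AtPrime.to_map_mem_maximal_iff O 𝔭 _).mpr hst)

variable (K : Type u) [Field K] [Algebra K A]

/-- **`p^e`-th roots in the residue field at a closed point.** `K` a PERFECT field of exponential characteristic `p`,
`A` a `K`-algebra of finite type, `𝔭 ⊂ A` maximal, `O = A_𝔭`: every element of the residue field of `O` is a `p^e`-th
power (`A/𝔭` is finite over `K` by Zariski's lemma, hence a perfect field, and `A/𝔭 → O/𝔪_O` is onto).
[cite: Matsumura1987, §4 (residue field of the localisation at a maximal ideal) and §5 (Thm. 5.3, Zariski's lemma)] -/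
theorem exists_pow_eq_residueField_of_perfectField [PerfectField K] (p : ℕ) [ExpChar K p]
    [Algebra.FiniteType K A] (𝔭 : Ideal A) [𝔭.IsMaximal] (O : Type*) [CommRing O] [IsLocalRing O] [Algebra A O]
    [IsLocalization.AtPrime O 𝔭] (e : ℕ) (x : ResidueField O) : ∃ y : ResidueField O, y ^ p ^ e = x := by
  -- `A ⧸ 𝔭` is a perfect field of exponential characteristic `p`
  letI := Ideal.Quotient.field 𝔭
  haveI : Algebra.FiniteType K (A ⧸ 𝔭) :=
    Algebra.FiniteType.of_surjective (Ideal.Quotient.mkₐ K 𝔭) (Ideal.Quotient.mkₐ_surjective K 𝔭)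
  haveI : Module.Finite K (A ⧸ 𝔭) := finite_of_finite_type_of_isJacobsonRing K (A ⧸ 𝔭)
  haveI : PerfectField (A ⧸ 𝔭) := Algebra.IsAlgebraic.perfectField K
  haveI : ExpChar (A ⧸ 𝔭) p := expChar_of_injective_algebraMap (algebraMap K (A ⧸ 𝔭)).injective p
  -- represent `x` by an element of `A`, take a root modulo `𝔭`, push to `O`
  obtain ⟨x0, rfl⟩ := residue_surjective x
  obtain ⟨a, ha⟩ := exists_algebraMap_sub_mem_maximalIdeal 𝔭 O x0
  obtain ⟨bbar, hbbar⟩ := (bijective_iterateFrobenius (A ⧸ 𝔭) p e).2 (Ideal.Quotient.mk 𝔭 a)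
  obtain ⟨b, rfl⟩ := Ideal.Quotient.mk_surjective bbar
  rw [iterateFrobenius_def, ← map_pow, Ideal.Quotient.eq] at hbbar
  refine ⟨residue O (algebraMap A O b), ?_⟩
  rw [← map_pow, ← map_pow]
  -- `residue (b^{p^e}/1) = residue (a/1) = residue x0`
  have h1 : residue O (algebraMap A O (b ^ p ^ e)) = residue O (algebraMap A O a) := by
    rw [← sub_eq_zero, ← map_sub, ← map_sub, residue_eq_zero_iff]
    exact (IsLocalization.AtPrime.to_map_mem_maximal_iff O 𝔭 _).mpr hbbar
  have h2 : residue O (algebraMap A O a) = residue O x0 := by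
    rw [← sub_eq_zero, ← map_sub, residue_eq_zero_iff]
    exact ha
  rw [h1, h2]

end Residue

/-! ## Chart-uniform purity -/

section ChartPurity

variable (K : Type u) [Field K] {σ : Type v} [Fintype σ] [DecidableEq σ]
  {A : Type w} [CommRing A] [Algebra K A] [Algebra (MvPolynomial σ K) A] [IsScalarTower K (MvPolynomial σ K) A]

/-- **Chart-uniform purity criterion.** `K` perfect of exponential characteristic `p`; `A` of finite type over `K`,
formally unramified over `K[X_σ]`; `T_A` a Hasse–Schmidt homomorphism fixing `K` with `T_A(x_i) = x_i + t_i`; `𝔭 ⊂ A`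
maximal, `O = A_𝔭`; `h ∈ 𝔭^{p^e}`. Then `h ≡ y^{p^e} (mod 𝔪_O^{p^e+1})` for some `y ∈ O` IFF `D^{[β]} h ∈ 𝔭` for every
NON-PURE `β` of degree `p^e` — membership of the GLOBAL functions `hsComponent T_A β h` in `𝔭`.
[cite: Matsumura1987, §27 and §30 (proof of Thm. 30.9)] [cite: EGAIV4, Thm. 16.11.2 and §17.6]
[cite: VillamayorU2008ReesDiff, §4.1 and Remark 4.3] [cite: Abad2019pBases, Lemma 6.2] -/
theorem sub_pow_mem_iff_hsComponent_mem_of_hasseSchmidt [PerfectField K] (p : ℕ) [ExpChar K p]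
    [Algebra.FormallyUnramified (MvPolynomial σ K) A] [Algebra.FiniteType K A]
    (TA : A →+* MvPowerSeries σ A) (hTA0 : ∀ a, constantCoeff (TA a) = a)
    (hTAK : ∀ c : K, TA (algebraMap K A c) = MvPowerSeries.C (algebraMap K A c))
    (hTAx : ∀ i, TA (algebraMap (MvPolynomial σ K) A (MvPolynomial.X i)) =
      MvPowerSeries.C (algebraMap (MvPolynomial σ K) A (MvPolynomial.X i)) + MvPowerSeries.X i)
    (𝔭 : Ideal A) [𝔭.IsMaximal] (O : Type*) [CommRing O] [IsLocalRing O] [Algebra A O]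
    [IsLocalization.AtPrime O 𝔭] (e : ℕ) {h : A} (hh : h ∈ 𝔭 ^ p ^ e) :
    (∃ y : O, algebraMap A O h - y ^ p ^ e ∈ maximalIdeal O ^ (p ^ e + 1)) ↔
      ∀ β : σ →₀ ℕ, degree β = p ^ e → (∀ m, β ≠ p ^ e • Finsupp.single m 1) → hsComponent TA β h ∈ 𝔭 := by
  -- localise `T_A`, adapted generators, characteristic and roots at `𝔭`
  letI : Algebra K O := ((algebraMap A O).comp (algebraMap K A)).toAlgebra
  haveI : IsScalarTower K A O := IsScalarTower.of_algebraMap_eq fun _ => rfl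
  haveI : ExpChar O p := expChar_of_injective_algebraMap (algebraMap K O).injective p
  obtain ⟨T, hT0, -, hT⟩ := exists_hasseSchmidt_localization TA O 𝔭.primeCompl hTA0 hTAK
  have hTcomp : ∀ (β : σ →₀ ℕ) (a : A),
      hsComponent T β (algebraMap A O a) = algebraMap A O (hsComponent TA β a) :=
    hsComponent_algebraMap_of_compatible TA O T hT
  obtain ⟨u, hu, hlin⟩ := exists_adaptedGenerators_of_hasseSchmidt K TA hTA0 hTAK hTAx 𝔭 O T hT0 hT
  have hroot := exists_pow_eq_residueField_of_perfectField (A := A) K p 𝔭 O e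
  have hh' : algebraMap A O h ∈ maximalIdeal O ^ p ^ e :=
    (mem_pow_iff_algebraMap_mem_maximalIdeal_pow 𝔭 O (p ^ e) h).mp hh
  rw [sub_pow_mem_iff_hsComponent_mem T p hT0 hu hlin hroot hh']
  refine forall_congr' fun β => forall_congr' fun _ => forall_congr' fun _ => ?_
  rw [hTcomp, IsLocalization.AtPrime.to_map_mem_maximal_iff O 𝔭]

/-- **Chart-uniform purity, explicit roots.** In the setting of `sub_pow_mem_iff_hsComponent_mem_of_hasseSchmidt`,
at every maximal `𝔭` (`O = A_𝔭`): the localisation `T` of `T_A` (compatible with `A → O`) has adapted generators `u_i`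
of `𝔪_O`, and for every `e` and every `h ∈ 𝔭^{p^e}` whose NON-PURE degree-`p^e` coefficients `D^{[β]} h` lie in `𝔭`
there is `a : σ → O` with `ā_m^{p^e} = (D^{[p^e e_m]} h / 1)‾` and `h − (Σ_m a_m u_m)^{p^e} ∈ 𝔪_O^{p^e+1}` — the root
linear form of the initial form of `h` at the point has as coefficients the `p^e`-th roots of the values of the PURE
global Hasse–Schmidt coefficients. [cite: Matsumura1987, §27 and §30 (proof of Thm. 30.9)] [cite: EGAIV4, Thm. 16.11.2
and §17.6] [cite: VillamayorU2008ReesDiff, §4.1 and Remark 4.3] [cite: Abad2019pBases, Lemma 6.2] -/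
theorem exists_adapted_and_roots_of_hasseSchmidt [PerfectField K] (p : ℕ) [ExpChar K p]
    [Algebra.FormallyUnramified (MvPolynomial σ K) A] [Algebra.FiniteType K A]
    (TA : A →+* MvPowerSeries σ A) (hTA0 : ∀ a, constantCoeff (TA a) = a)
    (hTAK : ∀ c : K, TA (algebraMap K A c) = MvPowerSeries.C (algebraMap K A c))
    (hTAx : ∀ i, TA (algebraMap (MvPolynomial σ K) A (MvPolynomial.X i)) =
      MvPowerSeries.C (algebraMap (MvPolynomial σ K) A (MvPolynomial.X i)) + MvPowerSeries.X i)
    (𝔭 : Ideal A) [𝔭.IsMaximal] (O : Type*) [CommRing O] [IsLocalRing O] [Algebra A O]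
    [IsLocalization.AtPrime O 𝔭] :
    ∃ (T : O →+* MvPowerSeries σ O) (u : σ → O),
      (∀ b, constantCoeff (T b) = b) ∧
      (∀ a, T (algebraMap A O a) = MvPowerSeries.map (algebraMap A O) (TA a)) ∧
      Ideal.span (Set.range u) = maximalIdeal O ∧
      (∀ i j, hsComponent T (single j 1) (u i) - (if i = j then 1 else 0) ∈ maximalIdeal O) ∧
      ∀ (e : ℕ) (h : A), h ∈ 𝔭 ^ p ^ e →
        (∀ β : σ →₀ ℕ, degree β = p ^ e → (∀ m, β ≠ p ^ e • Finsupp.single m 1) → hsComponent TA β h ∈ 𝔭) →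
        ∃ a : σ → O,
          (∀ m, residue O (a m) ^ p ^ e = residue O (algebraMap A O (hsComponent TA (p ^ e • single m 1) h))) ∧
          algebraMap A O h - (∑ m, a m * u m) ^ p ^ e ∈ maximalIdeal O ^ (p ^ e + 1) := by
  letI : Algebra K O := ((algebraMap A O).comp (algebraMap K A)).toAlgebra
  haveI : IsScalarTower K A O := IsScalarTower.of_algebraMap_eq fun _ => rfl
  haveI : ExpChar O p := expChar_of_injective_algebraMap (algebraMap K O).injective p
  obtain ⟨T, hT0, -, hT⟩ := exists_hasseSchmidt_localization TA O 𝔭.primeCompl hTA0 hTAK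
  have hTcomp : ∀ (β : σ →₀ ℕ) (a : A),
      hsComponent T β (algebraMap A O a) = algebraMap A O (hsComponent TA β a) :=
    hsComponent_algebraMap_of_compatible TA O T hT
  obtain ⟨u, hu, hlin⟩ := exists_adaptedGenerators_of_hasseSchmidt K TA hTA0 hTAK hTAx 𝔭 O T hT0 hT
  refine ⟨T, u, hT0, hT, hu, hlin, fun e h hh hD => ?_⟩
  have hroot := exists_pow_eq_residueField_of_perfectField (A := A) K p 𝔭 O e
  have hh' : algebraMap A O h ∈ maximalIdeal O ^ p ^ e :=
    (mem_pow_iff_algebraMap_mem_maximalIdeal_pow 𝔭 O (p ^ e) h).mp hh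
  have hD' : ∀ β : σ →₀ ℕ, degree β = p ^ e → (∀ m, β ≠ p ^ e • Finsupp.single m 1) →
      hsComponent T β (algebraMap A O h) ∈ maximalIdeal O := by
    intro β hβ hne
    rw [hTcomp]
    exact (IsLocalization.AtPrime.to_map_mem_maximal_iff O 𝔭 _).mpr (hD β hβ hne)
  obtain ⟨a, ha, hsub⟩ := exists_sum_mul_sub_pow_mem_of_hsComponent_mem T p hT0 hu hlin hroot hh' hD'
  refine ⟨a, fun m => ?_, hsub⟩
  rw [ha m, hTcomp]

end ChartPurity

end Literature.AlgebraicGeometry.Resolution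

end
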